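import Literature.AnabelianGeometry.AbsoluteAnabelian.AbsTopICuspidalDecompositionSubProofs
import Literature.AnabelianGeometry.AbsoluteAnabelian.AbsTopICuspidalDecompositionSubDualProofs
import Mathlib.NumberTheory.Padics.PadicVal.Basic
import HarnessLib

/-!
# [AbsTopI] Lemma 4.5 (iii): the four typed predicates — universal closures REFUTED, exact
# conditional / instance forms PROVED

Proof-only companion of `AbsTopICharacterRank.lean` (S. Mochizuki, *Topics in Absolute Anabelian
Geometry I: Generalities* [MochizukiAbsTopI2012], Lemma 4.5 (iii), kurims manuscript p. 54) for the
abc-iut FACT-LIST rows F-0222 `Lem45iii_cuspCount`, F-0223 `Lem45iii_cycloClass`, F-0224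
`Lem45iii_det`, F-0225 `RealisedWeight` (cell abc-iut, block F, seat abc-iut-f-062).  All four are
PARAMETRISED predicates on abstract input data `(χ^{cyclo}, V = H^{ab} ⊗ ℚ_l [, numCusps | w])`
(typing policy θ of the trunk file: "no closed `∃`-statement over such data is asserted (it would be
refutable by junk data)").  This file records, in the kernel, exactly what can be said of them
WITHOUT the étale-`π₁` model:

* **Universal closures are FALSE** (explicit junk data, `G = ℚˣ` discrete, `K = V = ℚ`,
  `χ^{cyclo} = id`, trivial action): `not_forall_realisedWeight`, `not_forall_lem45iii_det`,
  `not_forall_lem45iii_cycloClass`, `not_forall_lem45iii_cuspCount` — so none of the four rows is a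
  closed fact; they are schemata whose instances at curve data are the content of (iii).
  Schema-level negative instances behind them: `realisedWeight_one` (relative to the TRIVIAL
  cyclotomic character every weight is realised, hence) `not_lem45iii_cycloClass_one`;
  `not_lem45iii_det_one` (trivial action, `χ^{cyclo}` of infinite order);
  `not_isQCyclotomicOfWeightK_id_rat_one` (over `ℚ` there is no `ℚ`-cyclotomic character of weight
  `1` relative to `id : ℚˣ → ℚˣ`, by the `2`-adic valuation); `lem45iii_cuspCount_unique` /
  `not_forall_numCusps_lem45iii_cuspCount` (the cusp count is determined by `(χ^{cyclo}, V)`).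
* **Exact conditional forms** (the instance forms the sub-DAG `AbsTopICuspidalDecompositionSub*`
  consumes, with every ALGEBRA input discharged): `lem45iii_cuspCount_iff` — (iii) third sentence
  ⟺ the [CombGC] Cor. 2.7 (i) weight count A9 `CuspCountViaWeights` (A10 `DualRankEq` is proved);
  `lem45iii_cycloClass_of_realisedWeightsSymmetric` — (iii) second sentence ⟸ the single printed
  input A7 = [CombGC] Prop. 2.4 (vii) (A1, A5, A6 proved); (iii) first sentence ⟸ A3 is the trunk's
  `detQCyclotomicOfDetSq_holds`.  Non-vacuity: `lem45iii_cuspCount_one_one_iff` (trivial data ⟹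
  exactly one "cusp").
No new definitions.  HONEST FRAMING: refereed pre-IUT anabelian geometry; a refuted universal
closure refutes OUR schema's closure over arbitrary data, not the printed Lemma 4.5 (iii); nothing
here bears on [IUTchIII] Cor. 3.12.
-/

noncomputable section

open scoped Classical

namespace Literature.AnabelianGeometry.AbsoluteAnabelian.AbsTopI

universe u v w'

section Schema

variable {G : Type u} [Group G] [TopologicalSpace G]
variable {K : Type v} [Field K]
variable {V : Type w'} [AddCommGroup V] [Module K V]

/-! ### F-0225 `RealisedWeight`: relative to the trivial cyclotomic character every weight is realised -/

omit [TopologicalSpace G] in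
/-- A character of finite order is `ℚ`-cyclotomic of EVERY weight relative to the trivial
character (`χ^{2b·den w} = 1 = 1^{b·num w}`, `w = 2(b·num w)/(2b·den w)`): the weight calculus of
[AbsTopI] p. 54 degenerates when `χ^{cyclo}` is torsion. [cite: MochizukiAbsTopI2012, Lemma 4.5 p.54] -/
theorem isQCyclotomicOfWeightK_one_of_pow_eq_one {χ : G →* Kˣ} {b : ℤ} (hb : 0 < b)
    (h : ∀ g : G, χ g ^ b = 1) (w : ℚ) : IsQCyclotomicOfWeightK (1 : G →* Kˣ) χ w := by
  refine ⟨b * w.num, 2 * b * w.den, by positivity, fun g => ?_, ?_⟩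
  · rw [MonoidHom.one_apply, one_zpow, show (2 * b * (w.den : ℤ)) = b * (2 * w.den) by ring,
      zpow_mul, h g, one_zpow]
  · have hbq : (b : ℚ) ≠ 0 := by exact_mod_cast hb.ne'
    have hd : (w.den : ℚ) ≠ 0 := by exact_mod_cast w.den_ne_zero
    calc w = (w.num : ℚ) / (w.den : ℚ) := (Rat.num_div_den w).symm
      _ = 2 * ((b * w.num : ℤ) : ℚ) / ((2 * b * w.den : ℤ) : ℚ) := by
        push_cast
        field_simp

/-- **F-0225, schema-level**: relative to the TRIVIAL cyclotomic character `χ^{cyclo} = 1`, every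
rational weight is realised by `V ⊕ K` (the realiser of weight `0` supplied by sub-node A6 has
finite order, hence every weight). [cite: MochizukiAbsTopI2012, Lemma 4.5 (iii) p.54] -/
theorem realisedWeight_one [FiniteDimensional K V] (ρV : G →* (V ≃ₗ[K] V)) (w : ℚ) :
    RealisedWeight (1 : G →* Kˣ) ρV w := by
  obtain ⟨χ₀, ⟨a, b, hb, hχ, -⟩, hne⟩ :=
    (zeroWeightRealised_holds (1 : G →* Kˣ) ρV : RealisedWeight (1 : G →* Kˣ) ρV 0)
  have hχ' : ∀ g : G, χ₀ g ^ b = 1 := fun g => by simpa using hχ g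
  exact ⟨χ₀, isQCyclotomicOfWeightK_one_of_pow_eq_one hb hχ' w, hne⟩

/-! ### F-0223 `Lem45iii_cycloClass` -/

/-- **F-0223, schema-level refutation**: relative to the trivial cyclotomic character the realised
weights are ALL of `ℚ`, so they have no maximum and `Lem45iii_cycloClass 1 V` fails for every
finite-dimensional `V` — the predicate is not a closed fact; its content is carried by the INPUT
A7 ([CombGC] Prop. 2.4 (vii)). [cite: MochizukiAbsTopI2012, Lemma 4.5 (iii) p.54] -/
theorem not_lem45iii_cycloClass_one [FiniteDimensional K V] (ρV : G →* (V ≃ₗ[K] V)) :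
    ¬ Lem45iii_cycloClass (1 : G →* Kˣ) ρV := by
  rintro ⟨wmax, wmin, hmax, -, -⟩
  have h := hmax.2 (show wmax + 1 ∈ {w | RealisedWeight (1 : G →* Kˣ) ρV w} from
    realisedWeight_one ρV (wmax + 1))
  linarith

/-- **F-0223, exact conditional form**: [AbsTopI] Lemma 4.5 (iii), second sentence, follows from
the SINGLE printed input A7 `RealisedWeightsSymmetric` ([CombGC] Prop. 2.4 (vii): the realised
weights are finite and symmetric under `λ ↦ 2 − λ`) — the algebra inputs A1, A5, A6 of sub-node A8
are discharged. [cite: MochizukiAbsTopI2012, Lemma 4.5 (iii) p.54]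
[cite: MochizukiCombGC2007, Prop. 2.4 (vii) p.20] -/
theorem lem45iii_cycloClass_of_realisedWeightsSymmetric [FiniteDimensional K V] (χcyclo : G →* Kˣ)
    (ρV : G →* (V ≃ₗ[K] V)) (hA7 : RealisedWeightsSymmetric χcyclo ρV) :
    Lem45iii_cycloClass χcyclo ρV := by
  have h := cycloClassOfSymmetry_holds χcyclo ρV
  unfold CycloClassOfSymmetry at h
  exact h (sameWeightPowerEquivalent_holds χcyclo) (cycloWeightTwoTrivialWeightZero_holds χcyclo)
    (zeroWeightRealised_holds χcyclo ρV) hA7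

/-! ### F-0224 `Lem45iii_det` -/

omit [TopologicalSpace G] in
/-- The determinant character of the trivial action is trivial. [cite: MochizukiAbsTopI2012, Lemma 4.5 (iii) p.54] -/
theorem detChar_one : detChar (1 : G →* (V ≃ₗ[K] V)) = 1 := by
  ext g
  simp [detChar]

omit [TopologicalSpace G] in
/-- **F-0224, schema-level refutation**: for the TRIVIAL action and a cyclotomic character of
infinite order (no positive power trivial — as for the genuine `χ^{cyclo}` of a `p`-adic or number
field), `Lem45iii_det` fails: `det = 1` is `ℚ`-cyclotomic of weight `0` only.  So the predicate is
not a closed fact; its content is the INPUT A3 ([CombGC] Prop. 2.4 (iii)), cf. the trunk's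
`detQCyclotomicOfDetSq_holds`. [cite: MochizukiAbsTopI2012, Lemma 4.5 (iii) p.54] -/
theorem not_lem45iii_det_one (χcyclo : G →* Kˣ)
    (h : ∀ n : ℤ, 0 < n → ∃ g : G, χcyclo g ^ n ≠ 1) :
    ¬ Lem45iii_det χcyclo (1 : G →* (V ≃ₗ[K] V)) := by
  rintro ⟨w, hw, a, b, hb, hab, hwab⟩
  have ha : 0 < a := by
    have hbq : (0 : ℚ) < b := by exact_mod_cast hb
    have h1 : (0 : ℚ) < 2 * a / b := hwab ▸ hw
    have h2 : (0 : ℚ) < 2 * a := (div_pos_iff_of_pos_right hbq).1 h1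
    have h3 : (0 : ℚ) < a := by linarith
    exact_mod_cast h3
  obtain ⟨g, hg⟩ := h a ha
  apply hg
  have e := hab g
  rw [detChar_one, MonoidHom.one_apply, one_zpow] at e
  exact e.symm

omit [TopologicalSpace G] in
/-- Non-vacuity of F-0224: if the determinant character IS the cyclotomic character (e.g. the
"cyclotomic line" `K(1)`), `Lem45iii_det` holds with weight `2` (`a = b = 1`).
[cite: MochizukiAbsTopI2012, Lemma 4.5 (iii) p.54] -/
theorem lem45iii_det_of_detChar_eq {χcyclo : G →* Kˣ} {ρV : G →* (V ≃ₗ[K] V)}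
    (h : detChar ρV = χcyclo) : Lem45iii_det χcyclo ρV :=
  ⟨2, two_pos, 1, 1, one_pos, fun g => by rw [h], by norm_num⟩

/-! ### F-0222 `Lem45iii_cuspCount` -/

/-- **F-0222, exact form**: for finite-dimensional `V`, [AbsTopI] Lemma 4.5 (iii), third sentence
("`d_χ(H^{ab} ⊗ ℚ_l) + 1` copies of `Spec(k̃)`") is EQUIVALENT to the [CombGC] Cor. 2.7 (i) weight
count A9 `CuspCountViaWeights` (`τ(V(χ⁻¹)) − τ(V) + 1 = numCusps`), because A10
`τ(Hom(V, K)) = τ(V)` is proved (`dualRankEq_holds`). [cite: MochizukiAbsTopI2012, Lemma 4.5 (iii) p.54]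
[cite: MochizukiCombGC2007, Cor. 2.7 (i) proof p.23] -/
theorem lem45iii_cuspCount_iff [FiniteDimensional K V] (χcyclo : G →* Kˣ) (ρV : G →* (V ≃ₗ[K] V))
    (numCusps : ℕ) :
    Lem45iii_cuspCount χcyclo ρV numCusps ↔ CuspCountViaWeights χcyclo ρV numCusps := by
  have hA10 := dualRankEq_holds ρV
  unfold DualRankEq at hA10
  unfold Lem45iii_cuspCount CuspCountViaWeights dChi
  rw [hA10]
  constructor <;> intro h <;> linarith

/-- The cusp count asserted by `Lem45iii_cuspCount` is determined by `(χ^{cyclo}, V)`.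
[cite: MochizukiAbsTopI2012, Lemma 4.5 (iii) p.54] -/
theorem lem45iii_cuspCount_unique {χcyclo : G →* Kˣ} {ρV : G →* (V ≃ₗ[K] V)} {n n' : ℕ}
    (h : Lem45iii_cuspCount χcyclo ρV n) (h' : Lem45iii_cuspCount χcyclo ρV n') : n = n' := by
  unfold Lem45iii_cuspCount at h h'
  have e : (n : ℤ) = n' := by rw [h, h']
  exact_mod_cast e

/-- **F-0222, schema-level refutation**: `Lem45iii_cuspCount χ V numCusps` cannot hold for every
`numCusps` (it pins `numCusps` down), so the row's universal closure is false for ANY `(χ^{cyclo}, V)`.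
[cite: MochizukiAbsTopI2012, Lemma 4.5 (iii) p.54] -/
theorem not_forall_numCusps_lem45iii_cuspCount (χcyclo : G →* Kˣ) (ρV : G →* (V ≃ₗ[K] V)) :
    ¬ ∀ numCusps : ℕ, Lem45iii_cuspCount χcyclo ρV numCusps := fun h =>
  zero_ne_one (lem45iii_cuspCount_unique (h 0) (h 1))

/-- `d_1(V) = 0` for the trivial action and the trivial character (`τ(V) − τ(V^∨) = 0` by A10).
[cite: MochizukiAbsTopI2012, Lemma 4.5 (ii) p.54] -/
theorem dChi_one_one [FiniteDimensional K V] :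
    dChi (1 : G →* (V ≃ₗ[K] V)) (1 : G →* Kˣ) = 0 := by
  have hA10 := dualRankEq_holds (1 : G →* (V ≃ₗ[K] V))
  unfold DualRankEq at hA10
  have hinv : (1 : G →* Kˣ)⁻¹ = 1 := by ext g; simp
  unfold dChi
  rw [hinv, twist_one, hA10, sub_self]

/-- Non-vacuity of F-0222: at the trivial data the predicate holds for exactly one value,
`numCusps = 1`. [cite: MochizukiAbsTopI2012, Lemma 4.5 (iii) p.54] -/
theorem lem45iii_cuspCount_one_one_iff [FiniteDimensional K V] (numCusps : ℕ) :
    Lem45iii_cuspCount (1 : G →* Kˣ) (1 : G →* (V ≃ₗ[K] V)) numCusps ↔ numCusps = 1 := by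
  unfold Lem45iii_cuspCount
  rw [dChi_one_one, zero_add]
  exact_mod_cast Iff.rfl

end Schema

/-! ### The universal closures of the four rows are FALSE (explicit junk data over `ℚ`) -/

section UniversalClosures

/-- Over `ℚ` there is NO `ℚ`-cyclotomic character of weight `1` relative to `id : ℚˣ → ℚˣ`:
`χ(2)^{2a} = 2^{a}` with `a > 0` is impossible for the `2`-adic valuation (`2·a·v = a`).
[cite: MochizukiAbsTopI2012, Lemma 4.5 p.54] -/
theorem not_isQCyclotomicOfWeightK_id_rat_one (χ : ℚˣ →* ℚˣ) :
    ¬ IsQCyclotomicOfWeightK (MonoidHom.id ℚˣ) χ 1 := by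
  rintro ⟨a, b, hb, h, hw⟩
  have hbq : (b : ℚ) ≠ 0 := by exact_mod_cast hb.ne'
  have hb2 : b = 2 * a := by
    have e : (b : ℚ) = 2 * a := by
      rw [eq_div_iff hbq] at hw
      linarith
    exact_mod_cast e
  have ha : 0 < a := by omega
  set u : ℚˣ := Units.mk0 (2 : ℚ) two_ne_zero with hu
  have h2 := congrArg (fun x : ℚˣ => (x : ℚ)) (h u)
  simp only [Units.val_zpow_eq_zpow_val, MonoidHom.id_apply, hu, Units.val_mk0] at h2
  have h22 : padicValRat 2 (2 : ℚ) = 1 := by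
    have := padicValRat.self (p := 2) one_lt_two
    simpa using this
  have hv := congrArg (padicValRat 2) h2
  rw [padicValRat.zpow, padicValRat.zpow, h22, hb2, mul_one] at hv
  have hv' : a * (2 * padicValRat 2 ((χ (Units.mk0 (2 : ℚ) two_ne_zero) : ℚˣ) : ℚ)) = a * 1 := by
    linear_combination hv
  have := mul_left_cancel₀ ha.ne' hv'
  omega

/-- Hence weight `1` is not realised by any `ℚˣ`-module over `ℚ` relative to `id`.
[cite: MochizukiAbsTopI2012, Lemma 4.5 (iii) p.54] -/
theorem not_realisedWeight_id_rat_one [TopologicalSpace ℚˣ] {V : Type w'} [AddCommGroup V]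
    [Module ℚ V] (ρV : ℚˣ →* (V ≃ₗ[ℚ] V)) : ¬ RealisedWeight (MonoidHom.id ℚˣ) ρV 1 := by
  rintro ⟨χ, hχ, -⟩
  exact not_isQCyclotomicOfWeightK_id_rat_one χ hχ

/-- **F-0225: the universal closure of `RealisedWeight` is FALSE** (witness `G = ℚˣ` discrete,
`K = V = ℚ`, `χ^{cyclo} = id`, `w = 1`). [cite: MochizukiAbsTopI2012, Lemma 4.5 (iii) p.54] -/
theorem not_forall_realisedWeight :
    ¬ ∀ (G : Type) [Group G] [TopologicalSpace G] (K : Type) [Field K] (V : Type) [AddCommGroup V]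
        [Module K V] (χcyclo : G →* Kˣ) (ρV : G →* (V ≃ₗ[K] V)) (w : ℚ),
        RealisedWeight χcyclo ρV w := by
  intro h
  letI : TopologicalSpace ℚˣ := ⊥
  exact not_realisedWeight_id_rat_one (1 : ℚˣ →* (ℚ ≃ₗ[ℚ] ℚ)) (h ℚˣ ℚ ℚ (MonoidHom.id ℚˣ) 1 1)

/-- **F-0224: the universal closure of `Lem45iii_det` is FALSE** (witness `G = ℚˣ` acting
trivially on `V = ℚ`, `χ^{cyclo} = id`, of infinite order at `2`; `Lem45iii_det` carries no topology). [cite: MochizukiAbsTopI2012, Lemma 4.5 (iii) p.54] -/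
theorem not_forall_lem45iii_det :
    ¬ ∀ (G : Type) [Group G] (K : Type) [Field K] (V : Type) [AddCommGroup V]
        [Module K V] (χcyclo : G →* Kˣ) (ρV : G →* (V ≃ₗ[K] V)), Lem45iii_det χcyclo ρV := by
  intro h
  refine not_lem45iii_det_one (V := ℚ) (MonoidHom.id ℚˣ) (fun n hn => ?_) (h ℚˣ ℚ ℚ _ 1)
  refine ⟨Units.mk0 (2 : ℚ) two_ne_zero, fun e => ?_⟩
  have e' := congrArg (fun x : ℚˣ => (x : ℚ)) e
  simp only [Units.val_zpow_eq_zpow_val, MonoidHom.id_apply, Units.val_mk0, Units.val_one] at e'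
  have : (1 : ℚ) < 2 ^ n := one_lt_zpow₀ (by norm_num) hn
  exact this.ne' e'

/-- **F-0223: the universal closure of `Lem45iii_cycloClass` is FALSE** (witness `G = ℚˣ` discrete,
`K = V = ℚ`, TRIVIAL `χ^{cyclo}` and action: all weights realised, no maximum).
[cite: MochizukiAbsTopI2012, Lemma 4.5 (iii) p.54] -/
theorem not_forall_lem45iii_cycloClass :
    ¬ ∀ (G : Type) [Group G] [TopologicalSpace G] (K : Type) [Field K] (V : Type) [AddCommGroup V]
        [Module K V] (χcyclo : G →* Kˣ) (ρV : G →* (V ≃ₗ[K] V)), Lem45iii_cycloClass χcyclo ρV := by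
  intro h
  letI : TopologicalSpace ℚˣ := ⊥
  exact not_lem45iii_cycloClass_one (1 : ℚˣ →* (ℚ ≃ₗ[ℚ] ℚ)) (h ℚˣ ℚ ℚ 1 1)

/-- **F-0222: the universal closure of `Lem45iii_cuspCount` is FALSE** (for any data at all the
count is pinned down; witness `G = ℚˣ` discrete, `K = V = ℚ`). [cite: MochizukiAbsTopI2012, Lemma 4.5 (iii) p.54] -/
theorem not_forall_lem45iii_cuspCount :
    ¬ ∀ (G : Type) [Group G] [TopologicalSpace G] (K : Type) [Field K] (V : Type) [AddCommGroup V]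
        [Module K V] (χcyclo : G →* Kˣ) (ρV : G →* (V ≃ₗ[K] V)) (numCusps : ℕ),
        Lem45iii_cuspCount χcyclo ρV numCusps := by
  intro h
  letI : TopologicalSpace ℚˣ := ⊥
  exact not_forall_numCusps_lem45iii_cuspCount (MonoidHom.id ℚˣ) (1 : ℚˣ →* (ℚ ≃ₗ[ℚ] ℚ))
    (h ℚˣ ℚ ℚ _ _)

end UniversalClosures

end Literature.AnabelianGeometry.AbsoluteAnabelian.AbsTopI

end
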